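import Mathlib
import HarnessLib.Audit
import Summits.PneNP.PneNP.Theorems.PstarReaderGap

/-!
# The `K_{Δ,Δ}` cluster: the two-query bounds are tight up to constants (ROUND-24, calibration of T24.11c / T24.19 / the crux)

FRONTIER range-avoidance ladder, rung F-N3, ROUND 24 (cell `pnp-ideate`; restricted-model proof complexity — nothing here bears
on `P` versus `NP`).

The AND-cluster of the planner memo (ROUND-24-PRESEED §12, §13 R10(q)) made formal for EVERY `Δ`: the complete bipartite graph
`P × Q`, `|P| = |Q| = Δ`, with the two constraints `Σ_{P×Q} a_p a_q = 1` and `Σ_P a_p = 0` is an unsat, edge-minimal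
graph-quadratic system on a simple graph of maximum degree `Δ` with `Δ²` edges and `2` constraints (`cluster_witness`;
`Σ_{P×Q} a_p a_q = (Σ_P a)(Σ_Q a)`).  Consequences:

* `graphQuadGap_const_ge`: any constant `K` valid in `PstarGraphQuadGap.GraphQuadGap` at degree `Δ` has `Δ² ≤ 2K` (so
  `graphQuadGapTwo`'s `4Δ²·|W|` is tight up to the factor `8`);
* `exists_minInfeasible_readers`: through `PstarGraphQuadGapInstance.inst` (with the sharp degree bound `maxDegree_inst_sharp`) there
  are pure typed instances with simple overlaps, maximum degree `Δ` (`Δ ≥ 1`), boundary-expanding for EVERY radius, carrying a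
  minimal infeasible READER family of `Δ²` outputs under `2` parity constraints — so `PstarGapTwoReadersProof.card_le_eight` (`8Δ²`)
  is tight up to `8` (`gapTwoReaders_const_ge`), and the constant of the crux `PstarGapLemma.PstarGapLemmaSO` at degree `Δ` is at
  least `Δ²/2` (`gapLemmaSO_const_ge`) — the "necessarily `K ≥ Δ²/2`" of the crux docstring, now a theorem.
-/

set_option linter.dupNamespace false

open Finset Literature.Computability.Complexity
open Summit.PneNP.PneNP.Theorems.PstarPDT (parity)
open Summit.PneNP.PneNP.Theorems.PstarTyped (Typed)
open Summit.PneNP.PneNP.Theorems.PstarSALevel (varSet BoundaryExpanding SimpleOverlap)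
open Summit.PneNP.PneNP.Theorems.PstarGapLemma (MinInfeasible MaxDegree GapBound)
open Summit.PneNP.PneNP.Theorems.PstarGraphQuadGap (Edge QCon qval QHolds Simple EdgeMaxDegree Supported Unsat EdgeMinimal
  GraphQuadGap)
open Summit.PneNP.PneNP.Theorems.PstarGraphQuadGapInstance
open Summit.PneNP.PneNP.Theorems.PstarGraphQuadGapReduction (liftW card_liftW_le minInfeasible_univ)
open Summit.PneNP.PneNP.Theorems.PstarGapTwoReaders (IsReader)
open Summit.PneNP.PneNP.Theorems.PstarReaderGap (isReader_inst)

namespace Summit.PneNP.PneNP.Theorems.PstarGapCluster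

/-! ## The cluster system -/

section Cluster

variable (Δ : ℕ)

/-- Left vertex `p_i`. -/
def pv (i : Fin Δ) : Fin (Δ + Δ) := Fin.castAdd Δ i

/-- Right vertex `q_j`. -/
def qv (j : Fin Δ) : Fin (Δ + Δ) := Fin.natAdd Δ j

/-- The edge `(p_i, q_j)`. -/
def cedge (ij : Fin Δ × Fin Δ) : Edge (Δ + Δ) := (pv Δ ij.1, qv Δ ij.2)

/-- The complete bipartite edge set `P × Q`. -/
def cluster : Finset (Edge (Δ + Δ)) := ((univ : Finset (Fin Δ)) ×ˢ (univ : Finset (Fin Δ))).image (cedge Δ)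

/-- The left side `P`. -/
def Pset : Finset (Fin (Δ + Δ)) := (univ : Finset (Fin Δ)).image (pv Δ)

/-- The quadratic constraint `Σ_{P×Q} a_p a_q = 1`. -/
def quadCon : QCon (Δ + Δ) := (cluster Δ, ∅, true)

/-- The affine constraint `Σ_P a_p = 0`. -/
def linCon : QCon (Δ + Δ) := (∅, Pset Δ, false)

/-- The cluster system. -/
def clusterSystem : Finset (QCon (Δ + Δ)) := {quadCon Δ, linCon Δ}

/-- Value of a left vertex. -/
theorem pv_val (i : Fin Δ) : (pv Δ i).val = i.val := rfl

/-- Value of a right vertex. -/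
theorem qv_val (j : Fin Δ) : (qv Δ j).val = Δ + j.val := rfl

/-- `cedge` is injective. -/
theorem cedge_injective : Function.Injective (cedge Δ) := by
  rintro ⟨i, j⟩ ⟨i', j'⟩ h
  simp only [cedge, Prod.mk.injEq] at h
  rw [Fin.castAdd_injective _ _ h.1, Fin.natAdd_injective _ _ h.2]

/-- `Δ²` edges. -/
theorem card_cluster : (cluster Δ).card = Δ ^ 2 := by
  rw [cluster, card_image_of_injective _ (cedge_injective Δ), card_product, card_univ, Fintype.card_fin, sq]

/-- The cluster is a simple graph (left index `<` right index). -/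
theorem simple_cluster : Simple (cluster Δ) := by
  intro e he
  obtain ⟨ij, -, rfl⟩ := mem_image.1 he
  show pv Δ ij.1 < qv Δ ij.2
  rw [Fin.lt_def, pv_val, qv_val]
  omega

/-- Maximum degree `Δ`. -/
theorem edgeMaxDegree_cluster : EdgeMaxDegree Δ (cluster Δ) := by
  classical
  intro v
  by_cases hv : v.val < Δ
  · -- a left vertex: its edges are `(v, q_j)`
    have hsub : (cluster Δ).filter (fun e => e.1 = v ∨ e.2 = v) ⊆ (univ : Finset (Fin Δ)).image fun j => (v, qv Δ j) := by
      intro e he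
      obtain ⟨he, hve⟩ := mem_filter.1 he
      obtain ⟨ij, -, rfl⟩ := mem_image.1 he
      rcases hve with h | h
      · exact mem_image.2 ⟨ij.2, mem_univ _, by rw [← h]; rfl⟩
      · exfalso
        have := congrArg Fin.val h
        simp only [cedge, qv_val] at this
        omega
    exact (card_le_card hsub).trans (card_image_le.trans (by rw [card_univ, Fintype.card_fin]))
  · -- a right vertex: its edges are `(p_i, v)`
    have hsub : (cluster Δ).filter (fun e => e.1 = v ∨ e.2 = v) ⊆ (univ : Finset (Fin Δ)).image fun i => (pv Δ i, v) := by
      intro e he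
      obtain ⟨he, hve⟩ := mem_filter.1 he
      obtain ⟨ij, -, rfl⟩ := mem_image.1 he
      rcases hve with h | h
      · exfalso
        have := congrArg Fin.val h
        simp only [cedge, pv_val] at this
        omega
      · exact mem_image.2 ⟨ij.1, mem_univ _, by rw [← h]; rfl⟩
    exact (card_le_card hsub).trans (card_image_le.trans (by rw [card_univ, Fintype.card_fin]))

/-- The two constraints are distinct. -/
theorem quadCon_ne_linCon : quadCon Δ ≠ linCon Δ := by
  intro h
  have := congrArg (fun w : QCon (Δ + Δ) => w.2.2) h
  exact absurd this (by simp [quadCon, linCon])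

/-- Two constraints. -/
theorem card_clusterSystem : (clusterSystem Δ).card = 2 := by
  rw [clusterSystem, card_pair (quadCon_ne_linCon Δ)]

/-- Supported on the cluster. -/
theorem supported_clusterSystem : Supported (cluster Δ) (clusterSystem Δ) := by
  intro w hw
  simp only [clusterSystem, mem_insert, mem_singleton] at hw
  rcases hw with rfl | rfl
  · exact Subset.rfl
  · exact empty_subset _

/-- The number of monomials of the cluster that are on: `#{p ∈ P on} · #{q ∈ Q on}`. -/
theorem card_cluster_on (a : Fin (Δ + Δ) → Bool) :
    ((cluster Δ).filter fun e => a e.1 = true ∧ a e.2 = true).card =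
      ((univ : Finset (Fin Δ)).filter fun i => a (pv Δ i) = true).card *
        ((univ : Finset (Fin Δ)).filter fun j => a (qv Δ j) = true).card := by
  classical
  rw [cluster, filter_image, card_image_of_injective _ (cedge_injective Δ)]
  have : ((univ : Finset (Fin Δ)) ×ˢ (univ : Finset (Fin Δ))).filter (fun ij => a (cedge Δ ij).1 = true ∧ a (cedge Δ ij).2 = true) =
      (univ.filter fun i => a (pv Δ i) = true) ×ˢ (univ.filter fun j => a (qv Δ j) = true) := by
    ext ⟨i, j⟩
    simp [cedge]
  rw [this, card_product]

/-- The affine constraint holds iff evenly many left vertices are on. -/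
theorem qholds_linCon_iff (a : Fin (Δ + Δ) → Bool) :
    QHolds (linCon Δ) a ↔ Even ((univ : Finset (Fin Δ)).filter fun i => a (pv Δ i) = true).card := by
  classical
  have hpv : Function.Injective (pv Δ) := Fin.castAdd_injective _ _
  have hcard : ((Pset Δ).filter fun v => a v = true).card = ((univ : Finset (Fin Δ)).filter fun i => a (pv Δ i) = true).card := by
    rw [Pset, filter_image, card_image_of_injective _ hpv]
  unfold PstarGraphQuadGap.QHolds PstarGraphQuadGap.qval PstarPDT.parity
  rw [show (linCon Δ).1 = ∅ from rfl, show (linCon Δ).2.1 = Pset Δ from rfl, show (linCon Δ).2.2 = false from rfl, hcard]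
  simp

/-- The quadratic constraint holds iff oddly many monomials are on. -/
theorem qholds_quadCon_iff (a : Fin (Δ + Δ) → Bool) :
    QHolds (quadCon Δ) a ↔ Odd (((univ : Finset (Fin Δ)).filter fun i => a (pv Δ i) = true).card *
      ((univ : Finset (Fin Δ)).filter fun j => a (qv Δ j) = true).card) := by
  classical
  unfold PstarGraphQuadGap.QHolds PstarGraphQuadGap.qval
  rw [show (quadCon Δ).2.1 = ∅ from rfl, show (quadCon Δ).2.2 = true from rfl, show (quadCon Δ).1 = cluster Δ from rfl,
    card_cluster_on]
  simp [PstarPDT.parity]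

/-- **Unsat**: `(Σ_P a)(Σ_Q a) = 0` once `Σ_P a = 0`. -/
theorem unsat_clusterSystem : Unsat (clusterSystem Δ) := by
  rintro ⟨a, ha⟩
  have hl : QHolds (linCon Δ) a := ha _ (by simp [clusterSystem])
  have hq : QHolds (quadCon Δ) a := ha _ (by simp [clusterSystem])
  rw [qholds_linCon_iff] at hl
  rw [qholds_quadCon_iff] at hq
  exact (Nat.not_odd_iff_even.2 (hl.mul_right _)) hq

/-- **Edge-minimal**: the all-`false` assignment satisfies exactly the affine constraint. -/
theorem edgeMinimal_clusterSystem : EdgeMinimal (cluster Δ) (clusterSystem Δ) := by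
  classical
  intro e he
  refine ⟨fun _ => false, fun w hw => ?_⟩
  simp only [clusterSystem, mem_insert, mem_singleton] at hw
  rcases hw with rfl | rfl
  · rw [qholds_quadCon_iff]
    simpa [quadCon] using he
  · rw [qholds_linCon_iff]
    simp [linCon]

/-- **The cluster witness**: an unsat, edge-minimal graph-quadratic system with `Δ²` edges, `2` constraints, maximum degree `Δ`. -/
theorem cluster_witness : Simple (cluster Δ) ∧ EdgeMaxDegree Δ (cluster Δ) ∧ Supported (cluster Δ) (clusterSystem Δ) ∧
    Unsat (clusterSystem Δ) ∧ EdgeMinimal (cluster Δ) (clusterSystem Δ) ∧ (cluster Δ).card = Δ ^ 2 ∧ (clusterSystem Δ).card = 2 :=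
  ⟨simple_cluster Δ, edgeMaxDegree_cluster Δ, supported_clusterSystem Δ, unsat_clusterSystem Δ, edgeMinimal_clusterSystem Δ,
    card_cluster Δ, card_clusterSystem Δ⟩

/-- **Any graph-quadratic gap constant at degree `Δ` is at least `Δ²/2`.** -/
theorem graphQuadGap_const_ge (K : ℕ)
    (hK : ∀ (V : ℕ) (E : Finset (Edge V)) (W : Finset (QCon V)),
      Simple E → EdgeMaxDegree Δ E → Supported E W → Unsat W → EdgeMinimal E W → E.card ≤ K * W.card) :
    Δ ^ 2 ≤ 2 * K := by
  have h := hK _ _ _ (simple_cluster Δ) (edgeMaxDegree_cluster Δ) (supported_clusterSystem Δ) (unsat_clusterSystem Δ)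
    (edgeMinimal_clusterSystem Δ)
  rw [card_cluster, card_clusterSystem] at h
  linarith

end Cluster

/-! ## The reader family of the cluster -/

/-- **Sharp degree of the graph instance**: for `Δ ≥ 1`, `EdgeMaxDegree Δ E` gives `MaxDegree Δ` (AND variables lie on `≤ Δ`
edges, XOR variables in one output).  (`PstarGraphQuadGapInstance.maxDegree_inst` records `Δ + 1`; same proof.) -/
theorem maxDegree_inst_sharp {V Δ : ℕ} (E : Finset (Edge V)) (hΔ1 : 1 ≤ Δ) (hΔ : EdgeMaxDegree Δ E) : MaxDegree Δ (inst E) := by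
  classical
  intro w
  by_cases hw : ∃ v, w = av E v
  · obtain ⟨v, rfl⟩ := hw
    have h : (univ.filter fun j : Fin E.card => av E v ∈ varSet (inst E) j).card ≤ (E.filter fun e => e.1 = v ∨ e.2 = v).card := by
      refine card_le_card_of_injOn (edge E) (fun j hj => ?_) (fun j _ j' _ h => edge_injective E h)
      rw [mem_coe, mem_filter] at hj
      rw [mem_coe, mem_filter]
      exact ⟨edge_mem E j, (av_mem_varSet_iff j v).1 hj.2⟩
    exact h.trans (hΔ v)
  · push Not at hw
    have h1 : (univ.filter fun j : Fin E.card => w ∈ varSet (inst E) j).card ≤ 1 := by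
      rw [card_le_one]
      intro j hj j' hj'
      rw [mem_filter] at hj hj'
      rw [mem_varSet_iff] at hj hj'
      obtain ⟨-, hj⟩ := hj
      obtain ⟨-, hj'⟩ := hj'
      rcases hj with rfl | rfl | h | h
      · rcases hj' with h' | h' | h' | h'
        · exact Fin.castAdd_injective _ _ (Fin.castAdd_injective _ _ h')
        · have := congrArg Fin.val h'; simp [xv_val, xv'_val] at this; omega
        · exact absurd h' (hw _)
        · exact absurd h' (hw _)
      · rcases hj' with h' | h' | h' | h'
        · have := congrArg Fin.val h'; simp [xv_val, xv'_val] at this; omega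
        · exact Fin.natAdd_injective _ _ (Fin.castAdd_injective _ _ h')
        · exact absurd h' (hw _)
        · exact absurd h' (hw _)
      · exact absurd h (hw _)
      · exact absurd h (hw _)
    omega

/-- **The reader family of the cluster.**  For `Δ ≥ 1` there is a pure typed `P⋆` instance with simple overlaps, maximum degree
`Δ`, boundary-expanding for every radius, with a minimal infeasible READER family of `Δ²` outputs under at most `2` parity
constraints. -/
theorem exists_minInfeasible_readers {Δ : ℕ} (hΔ : 1 ≤ Δ) :
    ∃ (n m : ℕ) (I : LocalMap 4 n m) (y : Fin m → Bool) (W : Finset (Finset (Fin n) × Bool)) (J : Finset (Fin m)),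
      I.IsPure xorAndPred ∧ Typed I ∧ SimpleOverlap I ∧ MaxDegree Δ I ∧ (∀ r, BoundaryExpanding r I) ∧
        (∀ j ∈ J, IsReader I J j) ∧ W.card ≤ 2 ∧ MinInfeasible I y W J ∧ J.card = Δ ^ 2 := by
  refine ⟨_, _, inst (cluster Δ), fun _ => false, liftW (cluster Δ) (clusterSystem Δ), univ, isPure_inst (simple_cluster Δ),
    typed_inst, simpleOverlap_inst (simple_cluster Δ), maxDegree_inst_sharp _ hΔ (edgeMaxDegree_cluster Δ),
    boundaryExpanding_inst, fun j _ => isReader_inst _ univ j, ?_,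
    minInfeasible_univ (simple_cluster Δ) (supported_clusterSystem Δ) (unsat_clusterSystem Δ) (edgeMinimal_clusterSystem Δ), ?_⟩
  · exact (card_liftW_le _ _).trans (card_clusterSystem Δ).le
  · rw [card_univ, Fintype.card_fin, card_cluster]

/-- **T24.19 is tight up to the constant**: any bound `c` on minimal infeasible reader families under `≤ 2` constraints at degree
`Δ ≥ 1` (even restricted to instances boundary-expanding for every radius) has `Δ² ≤ c`; `card_le_eight` gives `c = 8Δ²`. -/
theorem gapTwoReaders_const_ge {Δ : ℕ} (hΔ : 1 ≤ Δ) (c : ℕ)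
    (hc : ∀ (n m r : ℕ) (I : LocalMap 4 n m), I.IsPure xorAndPred → Typed I → BoundaryExpanding r I → SimpleOverlap I →
      MaxDegree Δ I → ∀ (y : Fin m → Bool) (W : Finset (Finset (Fin n) × Bool)) (J : Finset (Fin m)),
        W.card ≤ 2 → J.card ≤ r → (∀ j ∈ J, IsReader I J j) → MinInfeasible I y W J → J.card ≤ c) :
    Δ ^ 2 ≤ c := by
  obtain ⟨n, m, I, y, W, J, hI, hT, hS, hD, hB, hR, hW, hmin, hJ⟩ := exists_minInfeasible_readers hΔ
  exact hJ ▸ hc n m J.card I hI hT (hB _) hS hD y W J hW le_rfl hR hmin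

/-- **The crux constant is at least `Δ²/2`**: any `K` valid in `PstarGapLemma.PstarGapLemmaSO` at degree `Δ ≥ 1` has `Δ² ≤ 2K`
(the `K_{Δ,Δ}` cluster of the crux docstring, as a theorem). -/
theorem gapLemmaSO_const_ge {Δ : ℕ} (hΔ : 1 ≤ Δ) (K : ℕ)
    (hK : ∀ (n m r : ℕ) (I : LocalMap 4 n m), I.IsPure xorAndPred → Typed I → BoundaryExpanding r I → SimpleOverlap I →
      MaxDegree Δ I → ∀ y : Fin m → Bool, GapBound K r I y) :
    Δ ^ 2 ≤ 2 * K := by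
  obtain ⟨n, m, I, y, W, J, hI, hT, hS, hD, hB, -, hW, hmin, hJ⟩ := exists_minInfeasible_readers hΔ
  have h := hK n m J.card I hI hT (hB _) hS hD y W J le_rfl hmin
  rw [hJ] at h
  calc Δ ^ 2 ≤ K * W.card := h
    _ ≤ K * 2 := Nat.mul_le_mul_left K hW
    _ = 2 * K := Nat.mul_comm K 2

end Summit.PneNP.PneNP.Theorems.PstarGapCluster
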